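import Summits.QuantumFields.BalabanUV.Beta.EriceRemainderEnclosureHistoryUniqueness
import Summits.QuantumFields.BalabanUV.Beta.EriceRemainderEnclosureHistoryRenewal

/-!
# EriceRemainderEnclosureHistoryFading — (E36a) THE FADING CONSTANT ENTERS THE RATIO ONLY: node U2's GEOMETRIC two-run matching
# shape costs an EXPONENTIAL AGE-MOMENT of the history modulus that is SMALL AGAINST THE AF WEIGHT SUM — `2·A³·U·M_κ ≤ 1`,
# `M_κ = sup_k Σ_{i≤k} Λ k i·κ^{i−k}` — and then `|1∕(g^A_j)² − 1∕(g^B_{j+1})²| ≤ (2c∕(1−θ))·κ^j`, K-UNIFORMLY; `FadingMemory C θ Λ`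
# with ANY constant `C` (no smallness on it) plus the ROW smallness of (E33) supplies such a moment at a ratio `κ(θ, C∕M) < 1`
# (a memory of finite DEPTH `N` does too, ratio `κ` with `κ^N ≥ 2A³UM`: companion (E36b))

Cell `pub-balaban`, β-function sub-cell, BINDER row D4 «RemainderConst leaves for Bałaban's split» (`HOME/BINDER-OWNERS.md`; owner
lineage `b2b-balaban-beta-an4`; this file by co-owner #2 lineage `b2b-balaban-beta-d4-p2`, generation 38), β-FLOW TEAM duty (1),
FREEZE (0) honoured (def-free module in the lineage's `EriceRemainderEnclosure*` series; no new leaf, no new hypothesis shape — the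
exponential age-moment is an INLINE hypothesis on node U2's `Λ`, never a `def`).  Sequel of (E33) `EriceRemainderEnclosureHistoryRenewal*`
(WITHOUT `FadingMemory`: stretched-exponential rate, exponent ½) and (E35) `EriceRemainderEnclosureHistoryRenewalWitness*` (the stretched
shape is SHARP over the class «rows ≤ M»: admissible witnesses beat every `C·κ^j`), over node U2's `T4CouplingMatching` (lineage
`b2b-balaban-pv16`; `disc`, `disc_step`, `FadingMemory`, `sum_weights_le_of_eventualLower` BY NAME), (E32)
`EriceRemainderEnclosureHistoryUniqueness` (`nearMono_of_sign` ∕ `nearMono_of_eventualLower`: asymptotic freedom orders the history)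
and (E33a) `EriceRemainderEnclosureHistoryRenewal` (`weight_le_of_nearMono`).  Companions: (E36b)
`EriceRemainderEnclosureHistoryFadingContinuum` (ONE ratio before the class; node U2's `InjectedRate` and `T4ContinuumCoupling`'s
package BY NAME; the finite-DEPTH supplier), (E36c) `EriceRemainderEnclosureHistoryFadingWitness` (the ratio cannot be uniform in the
fading constant: (E35)'s witnesses each HAVE a finite fading constant; quantitatively `log(1∕κ(C)) ≲ 1∕√log C`), (E36d)
`EriceRemainderEnclosureHistoryFadingColumn` (the SIGN-FREE road: node U2's own binder list with the smallness moved off the fading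
constant onto a tilted COLUMN budget), (E36e) `EriceRemainderEnclosureHistoryFadingWitnessEnvelope` (the two-parameter witnesses:
`log(1∕κ(C)) ≲ log log C∕log C`, matching §2's guaranteed `1∕log C` up to the double logarithm).

HONEST FRAMING (page 1, verbatim and binding).  *"Discharging BetaPertH makes Bałaban's UV stability UNCONDITIONAL — a real
constructive-QFT result; it is NOT the continuum limit and NOT the Clay problem."*  THIS FILE DISCHARGES NOTHING OF THE KIND.  It is
elementary real analysis on node U2's typed HYPOTHESIS SHAPES over an ABSTRACT family `β : FlowStep.HBeta` — `ScaleShiftRate c θ γ β`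
(NE4 for the full β; NOT PRINTED, GAPS G-t4-U2-1), `HistLipschitz Λ γ β` and `FadingMemory C θ Λ` (NOT PRINTED, GAPS G-t4-U2-2; [I]
p. 298 says only that the dependence on the preceding couplings exists), the floor `EventualLowerH b γ k₀ β` (shape of (0.31)'s lower
half) and the sign `BetaLowerH 0 γ β` — NONE asserted for [I] (1.22).  Nothing of Bałaban's is quoted newly: the loci behind the shapes
((0.20) p. 256, (0.31) p. 259, p. 264, p. 298) are quoted verbatim in the headers of `FlowStep` and `T4CouplingMatching`.  Row D4 class
UNCHANGED (critical-path width 0; instance 0∕1; D4 DISCHARGE NO DATE).  HONEST DEPENDENCY: continuum YM on T⁴ ⇐ BetaPertH ∧ nine spine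
estimates (0/9 proved); BetaPertH ⇐ (D1) ∧ (D4) ∧ CAP+tail; G-an2-4 gates asym, D1 and NE2/3/4.

THE POINT (census sense (α); the history channel's RATE row, the cell between node U2 and (E33)∕(E35)).  Node U2 closes the two-sided
recursion `δ_j ≤ δ_{j+1} + cθ^j + Σ_{i≤j} Λ j i·u_i·δ_i` (`u_i = (g^A_i)²g^B_{i+1}`, `δ = disc gA gB`, pin `δ_K = 0`) with `FadingMemory C θ Λ`
AND the smallness `C·U ≤ (1−θ)∕2` ON THE FADING CONSTANT (`disc_le_of_fadingMemory`: `δ_j ≤ (2c∕(1−θ))·θ^j`); (E33) replaces the decay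
by the k-uniform ROW total weight `Σ_{i≤k} Λ k i ≤ M` with `q = A³MU < 1` and gets a STRETCHED-exponential rate, which (E35) shows SHARP
over that class; the closing sentence of (E35) reads «node U2's smallness on the FADING constant is load-bearing for the geometric
SHAPE».  This file says what exactly is load-bearing: NOT the smallness of the fading constant but an EXPONENTIAL AGE-MOMENT of the
modulus at the target ratio — `Σ_{i≤k} Λ k i·κ^i ≤ M_κ·κ^k` for all `k` (i.e. `Σ_{ages n} Λ k (k−n)·κ^{−n} ≤ M_κ`) — SMALL AGAINST THE AF
WEIGHT SUM, `2·A³·U·M_κ ≤ 1` (§1 `geom_of_expMoment`, the bootstrap in the κ-weighted maximum `max_i δ_i κ^{−i}`; asymptotic freedom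
orders the history as in (E30)∕(E32)∕(E33): `u_i ≤ A³u_j`, `i ≤ j`, so every row is paid at the INFLUENCED scale and the rows are summed
with `Σ u ≤ U`).  Then (§2) `disc_j ≤ (2c∕(1−θ))·κ^j` for every `j ≤ K` — node U2's constant, ratio `κ`.  SUPPLIERS of the moment (§1):
`expMoment_of_fading` — caps `Λ k i ≤ Cθ^{k−i}` (`FadingMemory C θ Λ`, ANY `C ≥ 0`) + rows `≤ M` give, for every window `a` and every
`θ < κ ≤ 1`, `M_κ = (M + C·θ^{a+1}∕(κ−θ))∕κ^a` (ages `≤ a` by the row budget, older ages by the cap); (E36b) `expMoment_of_depth` — a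
memory of DEPTH `N` (`Λ k i = 0` for `i + N < k`) + rows `≤ M` give `M_κ = M∕κ^N` for every `0 < κ ≤ 1`.  CONSEQUENTLY (§2 ENDs): under
`FadingMemory C θ Λ` with an ARBITRARY constant the ROW smallness alone (`4·A³·M·U ≤ κ^a` once `C·θ^{a+1}∕(κ−θ) ≤ M`) gives the geometric
shape with ratio `κ`; the fading constant is paid in the RATIO — `log(1∕κ) ≍ log(1∕(4q))·log(1∕θ)∕log(C∕M)` — not in an admission
condition (and a memory of finite depth `N` and total strength `M` gives ratio `(2A³MU)^{1∕N}`: the η-exponent is inversely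
proportional to the DEPTH of the memory, (E36b)).  The history channel's moment table thus reads: zeroth age-moment (rows) → existence,
uniqueness, stretched rate ((E32)∕(E33)); logarithmic moment → the two-loop VALUE (road P3); first moment → the two-loop defect ((E30));
EXPONENTIAL moment at rate `1∕κ` → the GEOMETRIC shape with ratio `κ` (here).  What is NOT claimed: uniformity of `κ` in `C` — false by
(E35) ((E36c)∕(E36e)); the sign-free (column) road of node U2 — in THIS file the runs must be near-monotone (sign, or eventual floor +
two-sided bound), the sign-free road is (E36d); any statement about Bałaban's (1.22).

WHAT IS PROVED ([folklore] real analysis over the tree's shapes; 0 `def`, 0 sorry; nothing of [I] asserted).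
 §1 **`geom_of_expMoment`** (abstract kernel: `δ ≥ 0`, `δ_K = 0`, near-monotone summable weights, `Λ ≥ 0` with the κ-tilted row budget
    `Σ_{i≤l} Λ l i κ^i ≤ M_κ κ^l`, the recursion, `2·m·U·M_κ ≤ 1` ⟹ `δ_j ≤ (2c∕(1−θ))κ^j`), **`expMoment_of_fading`**.
 §2 **`disc_le_geom_of_expMoment`** (two pinned runs of (0.20), near-monotone with constant `A`), `disc_le_geom_of_expMoment_sign` (`A = 1`:
    sign + eventual floor, `U = (k₀+1)γ³ + 2γ∕b`), `disc_le_geom_of_expMoment_eventual` (`A = √2`: eventual floor + `β ≥ −β′` +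
    `k₀β′γ² ≤ 1∕2`), **`disc_le_geom_of_fading`** ∕ `disc_le_geom_of_fading_sign` (`FadingMemory C θ Λ`, ANY `C`, + rows `≤ M`).
-/

noncomputable section
open Finset

namespace Summit.QuantumFields.BalabanUV.Beta.EriceRemainderEnclosureHistoryFading

open Literature.MathematicalPhysics.QuantumFieldTheory.Balaban1983to89
open Literature.MathematicalPhysics.QuantumFieldTheory.Balaban1983to89.FlowStep
open Literature.MathematicalPhysics.QuantumFieldTheory.Balaban1983to89.T4CouplingMatching
open Summit.QuantumFields.BalabanUV.Beta.EriceRemainderEnclosureHistoryUniqueness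
  (nearMono_of_sign sign_along_of_betaLowerH nearMono_of_eventualLower)
open Summit.QuantumFields.BalabanUV.Beta.EriceRemainderEnclosureHistoryRenewal (weight_le_of_nearMono)

/-! ## §1 The arithmetic kernel: bootstrap in the κ-weighted maximum under an exponential age-moment -/

/-- **THE KERNEL — GEOMETRIC RATE FROM A SMALL EXPONENTIAL AGE-MOMENT.**  Let `0 ≤ θ < 1`, `θ ≤ κ ≤ 1`, `κ > 0`, `c ≥ 0`, `m ≥ 0`;
`δ ≥ 0` with the pin `δ_K = 0`; weights `u_i ≥ 0` (`i ≤ K`) with `Σ_{i≤K} u_i ≤ U`, near-monotone (`u_i ≤ m·u_j`, `i ≤ j ≤ K`); moduli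
`Λ ≥ 0` with the κ-TILTED ROW BUDGET `Σ_{i≤l} Λ l i·κ^i ≤ M_κ·κ^l` (an exponential moment in the age `l − i` at rate `1∕κ`); the two-sided
recursion `δ_j ≤ δ_{j+1} + cθ^j + Σ_{i≤j} Λ j i·u_i·δ_i` (`j < K`); SMALLNESS `2·m·U·M_κ ≤ 1`.  THEN `δ_j ≤ (2c∕(1−θ))·κ^j` for every
`j ≤ K`.  Proof: with `D = max_{i≤K} δ_i∕κ^i` the feedback of row `j` is `≤ m·u_j·D·M_κ·κ^j` (near-monotonicity pays the row at the
influenced scale, the tilted budget pays the ages); backward accumulation (`backward_sum`) and `Σ u ≤ U` give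
`δ_j∕κ^j ≤ c∕(1−θ) + m·U·M_κ·D`; at the maximiser the smallness absorbs `D`.  Node U2's `twoSided_fixedPoint` is the case `κ = θ`,
tilted budget from `FadingMemory` alone, `Σ u` inside the row (no monotonicity). [folklore] -/
theorem geom_of_expMoment {K : ℕ} {δ u : ℕ → ℝ} {Λ : ℕ → ℕ → ℝ} {θ κ c Mκ m U : ℝ}
    (hθ0 : 0 ≤ θ) (hθ1 : θ < 1) (hθκ : θ ≤ κ) (hκ0 : 0 < κ) (hκ1 : κ ≤ 1) (hc : 0 ≤ c) (hm : 0 ≤ m)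
    (hδ : ∀ j, 0 ≤ δ j) (hK : δ K = 0)
    (hu : ∀ i, i ≤ K → 0 ≤ u i) (hU : ∑ i ∈ range (K + 1), u i ≤ U)
    (hmono : ∀ i j, i ≤ j → j ≤ K → u i ≤ m * u j)
    (hΛ0 : ∀ l i, i ≤ l → 0 ≤ Λ l i)
    (hexp : ∀ l, ∑ i ∈ range (l + 1), Λ l i * κ ^ i ≤ Mκ * κ ^ l)
    (hrec : ∀ j, j < K → δ j ≤ δ (j + 1) + c * θ ^ j + ∑ i ∈ range (j + 1), Λ j i * u i * δ i)
    (hsmall : 2 * (m * U * Mκ) ≤ 1) :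
    ∀ j, j ≤ K → δ j ≤ 2 * c / (1 - θ) * κ ^ j := by
  have hne : (range (K + 1)).Nonempty := ⟨0, by simp⟩
  set D := (range (K + 1)).sup' hne (fun i => δ i / κ ^ i) with hD
  have hDi : ∀ i, i ≤ K → δ i ≤ D * κ ^ i := by
    intro i hi
    have h : δ i / κ ^ i ≤ D := le_sup' (fun i => δ i / κ ^ i) (mem_range.mpr (Nat.lt_succ_of_le hi))
    rwa [div_le_iff₀ (pow_pos hκ0 i)] at h
  have hD0 : 0 ≤ D := by
    have h : δ 0 / κ ^ 0 ≤ D := le_sup' (fun i => δ i / κ ^ i) (mem_range.mpr (Nat.succ_pos K))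
    have : (0 : ℝ) ≤ δ 0 / κ ^ 0 := by simpa using hδ 0
    exact this.trans h
  have hU0 : 0 ≤ U := (sum_nonneg fun i hi => hu i (Nat.lt_succ_iff.mp (mem_range.mp hi))).trans hU
  have hMκ0 : 0 ≤ Mκ := by
    have h := hexp 0
    rw [sum_range_one, pow_zero, mul_one, mul_one] at h
    exact (hΛ0 0 0 le_rfl).trans h
  have h1θ : 0 < 1 - θ := by linarith
  -- the feedback of row j, paid at the influenced scale with the tilted budget
  have hfb : ∀ j, j < K → ∑ i ∈ range (j + 1), Λ j i * u i * δ i ≤ m * u j * D * Mκ * κ ^ j := by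
    intro j hj
    calc ∑ i ∈ range (j + 1), Λ j i * u i * δ i
        ≤ ∑ i ∈ range (j + 1), Λ j i * (m * u j) * (D * κ ^ i) := by
          refine sum_le_sum fun i hi => ?_
          have hij : i ≤ j := Nat.lt_succ_iff.mp (mem_range.mp hi)
          have hiK : i ≤ K := hij.trans hj.le
          exact mul_le_mul (mul_le_mul_of_nonneg_left (hmono i j hij hj.le) (hΛ0 j i hij)) (hDi i hiK) (hδ i)
            (mul_nonneg (hΛ0 j i hij) (mul_nonneg hm (hu j hj.le)))
      _ = m * u j * D * ∑ i ∈ range (j + 1), Λ j i * κ ^ i := by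
          rw [mul_sum]
          exact sum_congr rfl fun i _ => by ring
      _ ≤ m * u j * D * (Mκ * κ ^ j) :=
          mul_le_mul_of_nonneg_left (hexp j) (mul_nonneg (mul_nonneg hm (hu j hj.le)) hD0)
      _ = m * u j * D * Mκ * κ ^ j := by ring
  have hrec' : ∀ j, j < K → δ j ≤ δ (j + 1) + (c * θ ^ j + m * D * Mκ * (u j * κ ^ j)) := by
    intro j hj
    have e : m * u j * D * Mκ * κ ^ j = m * D * Mκ * (u j * κ ^ j) := by ring
    linarith [hrec j hj, hfb j hj, e]
  have hE0 : 0 ≤ m * D * Mκ := mul_nonneg (mul_nonneg hm hD0) hMκ0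
  -- backward accumulation from the pin, summing the weights
  have hbound : ∀ j, j ≤ K → δ j ≤ (c / (1 - θ) + m * D * Mκ * U) * κ ^ j := by
    intro j hj
    have hb := backward_sum (le_of_eq hK) hrec' j hj
    have hsplit : ∑ i ∈ Ico j K, (c * θ ^ i + m * D * Mκ * (u i * κ ^ i))
        = c * ∑ i ∈ Ico j K, θ ^ i + m * D * Mκ * ∑ i ∈ Ico j K, u i * κ ^ i := by
      rw [sum_add_distrib, mul_sum, mul_sum]
    have hgeo : ∑ i ∈ Ico j K, θ ^ i ≤ θ ^ j / (1 - θ) := geom_sum_Ico_le_of_lt_one hθ0 hθ1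
    have hθκj : θ ^ j ≤ κ ^ j := pow_le_pow_left₀ hθ0 hθκ j
    have hsumu : ∑ i ∈ Ico j K, u i * κ ^ i ≤ U * κ ^ j := by
      calc ∑ i ∈ Ico j K, u i * κ ^ i ≤ ∑ i ∈ Ico j K, u i * κ ^ j := by
            refine sum_le_sum fun i hi => ?_
            have hi' := mem_Ico.mp hi
            exact mul_le_mul_of_nonneg_left (pow_le_pow_of_le_one hκ0.le hκ1 hi'.1) (hu i hi'.2.le)
        _ = (∑ i ∈ Ico j K, u i) * κ ^ j := by rw [sum_mul]
        _ ≤ U * κ ^ j := by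
            refine mul_le_mul_of_nonneg_right ?_ (pow_nonneg hκ0.le _)
            calc ∑ i ∈ Ico j K, u i ≤ ∑ i ∈ range (K + 1), u i :=
                  sum_le_sum_of_subset_of_nonneg
                    (fun i hi => mem_range.mpr (by have := (mem_Ico.mp hi).2; omega))
                    (fun i hi _ => hu i (Nat.lt_succ_iff.mp (mem_range.mp hi)))
              _ ≤ U := hU
    calc δ j ≤ ∑ i ∈ Ico j K, (c * θ ^ i + m * D * Mκ * (u i * κ ^ i)) := hb
      _ = c * ∑ i ∈ Ico j K, θ ^ i + m * D * Mκ * ∑ i ∈ Ico j K, u i * κ ^ i := hsplit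
      _ ≤ c * (θ ^ j / (1 - θ)) + m * D * Mκ * (U * κ ^ j) :=
          add_le_add (mul_le_mul_of_nonneg_left hgeo hc) (mul_le_mul_of_nonneg_left hsumu hE0)
      _ = c / (1 - θ) * θ ^ j + m * D * Mκ * U * κ ^ j := by ring
      _ ≤ c / (1 - θ) * κ ^ j + m * D * Mκ * U * κ ^ j :=
          add_le_add (mul_le_mul_of_nonneg_left hθκj (div_nonneg hc h1θ.le)) le_rfl
      _ = (c / (1 - θ) + m * D * Mκ * U) * κ ^ j := by ring
  -- the fixed point: at the maximiser the smallness absorbs D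
  obtain ⟨i₀, hi₀, hDi₀⟩ := exists_mem_eq_sup' hne (fun i => δ i / κ ^ i)
  have hi₀K : i₀ ≤ K := Nat.lt_succ_iff.mp (mem_range.mp hi₀)
  have hDle : D ≤ c / (1 - θ) + m * D * Mκ * U := by
    calc D = δ i₀ / κ ^ i₀ := hDi₀
      _ ≤ c / (1 - θ) + m * D * Mκ * U := by
          rw [div_le_iff₀ (pow_pos hκ0 i₀)]
          exact hbound i₀ hi₀K
  have hhalf : m * U * Mκ ≤ 1 / 2 := by linarith
  have hDfin : D ≤ 2 * c / (1 - θ) := by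
    have h1 : m * D * Mκ * U ≤ D * (1 / 2) := by
      have := mul_le_mul_of_nonneg_left hhalf hD0
      linarith [show m * D * Mκ * U = D * (m * U * Mκ) by ring]
    have h2 : D ≤ 2 * (c / (1 - θ)) := by linarith
    calc D ≤ 2 * (c / (1 - θ)) := h2
      _ = 2 * c / (1 - θ) := by ring
  intro j hj
  calc δ j ≤ D * κ ^ j := hDi j hj
    _ ≤ 2 * c / (1 - θ) * κ ^ j := mul_le_mul_of_nonneg_right hDfin (pow_nonneg hκ0.le _)

/-- **SUPPLIER — FADING CAPS PLUS A ROW BUDGET GIVE EVERY EXPONENTIAL MOMENT AT RATES `1∕κ < 1∕θ`.**  If `0 ≤ Λ l i ≤ C·θ^{l−i}`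
(`i ≤ l`; the caps of `FadingMemory C θ Λ`, ANY `C`) and `Σ_{i≤l} Λ l i ≤ M`, then for every window `a` and every `θ < κ ≤ 1`:
`Σ_{i≤l} Λ l i·κ^i ≤ ((M + C·θ^{a+1}∕(κ−θ))∕κ^a)·κ^l` — ages `≤ a` pay through the row budget (`κ^i ≤ κ^l∕κ^a`), ages `> a` through
the caps (`Σ_{n>a} C(θ∕κ)^n`).  The fading constant enters through `C·θ^{a+1}`: choosing `a ≍ log(C∕M)∕log(1∕θ)` makes the moment `≍ 2M∕κ^a`.
[folklore] -/
theorem expMoment_of_fading {Λ : ℕ → ℕ → ℝ} {θ κ C M : ℝ} (a : ℕ) {l : ℕ}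
    (hθ0 : 0 ≤ θ) (hθκ : θ < κ) (hκ1 : κ ≤ 1)
    (hΛ0 : ∀ i, i ≤ l → 0 ≤ Λ l i) (hfade : ∀ i, i ≤ l → Λ l i ≤ C * θ ^ (l - i))
    (hrow : ∑ i ∈ range (l + 1), Λ l i ≤ M) :
    ∑ i ∈ range (l + 1), Λ l i * κ ^ i ≤ (M + C * θ ^ (a + 1) / (κ - θ)) / κ ^ a * κ ^ l := by
  have hκ0 : 0 < κ := lt_of_le_of_lt hθ0 hθκ
  have hκne : κ ≠ 0 := hκ0.ne'
  have hκa : 0 < κ ^ a := pow_pos hκ0 a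
  have hκθ : 0 < κ - θ := by linarith
  have hκθne : κ - θ ≠ 0 := hκθ.ne'
  have hr0 : 0 ≤ θ / κ := div_nonneg hθ0 hκ0.le
  have hr1 : θ / κ < 1 := (div_lt_one hκ0).mpr hθκ
  have hC : 0 ≤ C := by
    have h := (hΛ0 l le_rfl).trans (hfade l le_rfl)
    simpa using h
  have hM : 0 ≤ M := (sum_nonneg fun i hi => hΛ0 i (Nat.lt_succ_iff.mp (mem_range.mp hi))).trans hrow
  -- the tail profile, as a function of the age
  obtain ⟨g, hg⟩ : ∃ g : ℕ → ℝ, ∀ n, g n = if a + 1 ≤ n then (θ / κ) ^ n else 0 := ⟨_, fun _ => rfl⟩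
  have hg0 : ∀ n, 0 ≤ g n := fun n => by rw [hg]; split_ifs <;> positivity
  have hterm : ∀ i ∈ range (l + 1), Λ l i * κ ^ i ≤ Λ l i * (κ ^ l / κ ^ a) + C * κ ^ l * g (l - i) := by
    intro i hi
    have hil : i ≤ l := Nat.lt_succ_iff.mp (mem_range.mp hi)
    by_cases h : a + 1 ≤ l - i
    · have hgi : g (l - i) = (θ / κ) ^ (l - i) := by rw [hg, if_pos h]
      have e : κ ^ l * (θ / κ) ^ (l - i) = θ ^ (l - i) * κ ^ i := by
        rw [div_pow, ← pow_sub_mul_pow κ hil]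
        field_simp
      calc Λ l i * κ ^ i ≤ C * θ ^ (l - i) * κ ^ i := mul_le_mul_of_nonneg_right (hfade i hil) (pow_nonneg hκ0.le _)
        _ = C * κ ^ l * g (l - i) := by rw [hgi, mul_assoc, mul_assoc, e]
        _ ≤ Λ l i * (κ ^ l / κ ^ a) + C * κ ^ l * g (l - i) :=
            le_add_of_nonneg_left (mul_nonneg (hΛ0 i hil) (by positivity))
    · have hgz : g (l - i) = 0 := by rw [hg, if_neg h]
      have hκi : κ ^ i ≤ κ ^ l / κ ^ a := by
        rw [le_div_iff₀ hκa, ← pow_add]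
        exact pow_le_pow_of_le_one hκ0.le hκ1 (by omega)
      calc Λ l i * κ ^ i ≤ Λ l i * (κ ^ l / κ ^ a) := mul_le_mul_of_nonneg_left hκi (hΛ0 i hil)
        _ = Λ l i * (κ ^ l / κ ^ a) + C * κ ^ l * g (l - i) := by rw [hgz, mul_zero, add_zero]
  -- the tail sum, reflected onto the ages
  have hgsum : ∑ i ∈ range (l + 1), g (l - i) ≤ (θ / κ) ^ (a + 1) / (1 - θ / κ) := by
    have hrefl : ∑ i ∈ range (l + 1), g (l - i) = ∑ n ∈ range (l + 1), g n := by
      have h := sum_range_reflect g (l + 1)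
      simpa only [Nat.add_sub_cancel] using h
    rw [hrefl]
    have hfil : ∑ n ∈ range (l + 1), g n = ∑ n ∈ (range (l + 1)).filter (fun n => a + 1 ≤ n), (θ / κ) ^ n := by
      rw [sum_filter]
      exact sum_congr rfl fun n _ => hg n
    rw [hfil]
    calc ∑ n ∈ (range (l + 1)).filter (fun n => a + 1 ≤ n), (θ / κ) ^ n
        ≤ ∑ n ∈ Ico (a + 1) (l + 1), (θ / κ) ^ n := by
          refine sum_le_sum_of_subset_of_nonneg ?_ (fun n _ _ => pow_nonneg hr0 n)
          intro n hn
          simp only [mem_filter, mem_range] at hn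
          exact mem_Ico.mpr ⟨hn.2, hn.1⟩
      _ ≤ (θ / κ) ^ (a + 1) / (1 - θ / κ) := geom_sum_Ico_le_of_lt_one hr0 hr1
  have htail : (θ / κ) ^ (a + 1) / (1 - θ / κ) = θ ^ (a + 1) / (κ ^ a * (κ - θ)) := by
    have h1 : 1 - θ / κ = (κ - θ) / κ := by field_simp
    rw [h1, div_pow, pow_succ κ a]
    field_simp
  -- assemble
  calc ∑ i ∈ range (l + 1), Λ l i * κ ^ i
      ≤ ∑ i ∈ range (l + 1), (Λ l i * (κ ^ l / κ ^ a) + C * κ ^ l * g (l - i)) := sum_le_sum hterm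
    _ = (∑ i ∈ range (l + 1), Λ l i) * (κ ^ l / κ ^ a) + C * κ ^ l * ∑ i ∈ range (l + 1), g (l - i) := by
        rw [sum_add_distrib, sum_mul, mul_sum]
    _ ≤ M * (κ ^ l / κ ^ a) + C * κ ^ l * (θ ^ (a + 1) / (κ ^ a * (κ - θ))) := by
        refine add_le_add (mul_le_mul_of_nonneg_right hrow (by positivity)) ?_
        rw [← htail]
        exact mul_le_mul_of_nonneg_left hgsum (by positivity)
    _ = (M + C * θ ^ (a + 1) / (κ - θ)) / κ ^ a * κ ^ l := by
        field_simp

/-! ## §2 Run level: node U2's binder list with the smallness moved from the fading constant to the exponential moment -/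

/-- **TWO PINNED RUNS — GEOMETRIC MATCHING FROM A SMALL EXPONENTIAL AGE-MOMENT.**  Two runs of (0.20) with the SAME history family `β`
— A: `K` steps, B: `K + 1` steps — all couplings in ]0,γ], pinned `g^A_K = g^B_{K+1}`; NE4 as `ScaleShiftRate c θ γ β` (`c ≥ 0`,
`0 ≤ θ < 1`); history moduli `HistLipschitz Λ γ β`, `Λ ≥ 0`, with the κ-tilted row budget `Σ_{i≤k} Λ k i·κ^i ≤ M_κ·κ^k`
(`θ ≤ κ ≤ 1`, `κ > 0`); near-monotone runs (`g^X_i ≤ A·g^X_j`, `i ≤ j`); the AF weight bound `Σ_{i≤K} (g^A_i)²g^B_{i+1} ≤ U`; SMALLNESS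
`2·A³·U·M_κ ≤ 1`.  THEN `|1∕(g^A_j)² − 1∕(g^B_{j+1})²| ≤ (2c∕(1−θ))·κ^j` for every `j ≤ K` — node U2's constant, ratio `κ`.  Every
hypothesis on `β` is an UNPRINTED input (GAPS G-t4-U2-1∕-2); the theorem is bookkeeping (node U2's `disc_step` + §1).
[cite: Balaban1987RG1, (0.20) p.256 and §5 p.298] -/
theorem disc_le_geom_of_expMoment {β : HBeta} {γ c θ κ Mκ A U : ℝ} {Λ : ℕ → ℕ → ℝ} {K : ℕ} {gA gB : ℕ → ℝ}
    (hc : 0 ≤ c) (hθ0 : 0 ≤ θ) (hθ1 : θ < 1) (hθκ : θ ≤ κ) (hκ0 : 0 < κ) (hκ1 : κ ≤ 1)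
    (hA : RGEqH K β gA) (hB : RGEqH (K + 1) β gB)
    (hAbox : ∀ i, i ≤ K → 0 < gA i ∧ gA i ≤ γ) (hBbox : ∀ i, i ≤ K + 1 → 0 < gB i ∧ gB i ≤ γ)
    (hpin : gA K = gB (K + 1))
    (hS : ScaleShiftRate c θ γ β) (hL : HistLipschitz Λ γ β) (hΛ : ∀ k i, i ≤ k → 0 ≤ Λ k i)
    (hexp : ∀ k, ∑ i ∈ range (k + 1), Λ k i * κ ^ i ≤ Mκ * κ ^ k) (hA0 : 0 ≤ A)
    (hmA : ∀ i j, i ≤ j → j ≤ K → gA i ≤ A * gA j) (hmB : ∀ i j, i ≤ j → j ≤ K + 1 → gB i ≤ A * gB j)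
    (hU : ∑ i ∈ range (K + 1), (gA i) ^ 2 * gB (i + 1) ≤ U) (hsmall : 2 * (A ^ 3 * U * Mκ) ≤ 1) :
    ∀ j, j ≤ K → disc gA gB j ≤ 2 * c / (1 - θ) * κ ^ j := by
  have hu : ∀ i, i ≤ K → 0 ≤ (gA i) ^ 2 * gB (i + 1) := fun i hi =>
    mul_nonneg (sq_nonneg _) (hBbox (i + 1) (by omega)).1.le
  refine geom_of_expMoment (u := fun i => (gA i) ^ 2 * gB (i + 1)) (m := A ^ 3) hθ0 hθ1 hθκ hκ0 hκ1 hc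
    (pow_nonneg hA0 3) (disc_nonneg gA gB) (disc_pin hpin) hu hU ?_ hΛ hexp ?_ hsmall
  · intro i j hij hjK
    exact weight_le_of_nearMono (fun i hi => (hAbox i hi).1) (fun i hi => (hBbox i hi).1) hmA hmB hij hjK
  · intro j hj
    exact disc_step hA hB hAbox hBbox hS hL hΛ hj

/-- **SIGN FORM** (`A = 1`): two pinned runs as above under `ScaleShiftRate c θ γ β`, `HistLipschitz Λ γ β` (`Λ ≥ 0`) with the tilted
row budget `Σ_{i≤k} Λ k i·κ^i ≤ M_κ·κ^k`, the SIGN `BetaLowerH 0 γ β` (the runs increase towards the pin: (E32) `nearMono_of_sign` BY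
NAME) and the eventual floor `EventualLowerH b γ k₀ β`, `b > 0` (node U2's K-uniform weight sum `U = (k₀+1)γ³ + 2γ∕b`,
`sum_weights_le_of_eventualLower` BY NAME); SMALLNESS `2·U·M_κ ≤ 1`.  THEN `disc gA gB j ≤ (2c∕(1−θ))·κ^j` for every `j ≤ K`.
[cite: Balaban1987RG1, (0.20) p.256 and (0.31) p.259] -/
theorem disc_le_geom_of_expMoment_sign {β : HBeta} {γ b c θ κ Mκ : ℝ} {k₀ : ℕ} {Λ : ℕ → ℕ → ℝ} {K : ℕ} {gA gB : ℕ → ℝ}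
    (hγ : 0 < γ) (hb : 0 < b) (hc : 0 ≤ c) (hθ0 : 0 ≤ θ) (hθ1 : θ < 1) (hθκ : θ ≤ κ) (hκ0 : 0 < κ) (hκ1 : κ ≤ 1)
    (hA : RGEqH K β gA) (hB : RGEqH (K + 1) β gB)
    (hAbox : ∀ i, i ≤ K → 0 < gA i ∧ gA i ≤ γ) (hBbox : ∀ i, i ≤ K + 1 → 0 < gB i ∧ gB i ≤ γ)
    (hpin : gA K = gB (K + 1))
    (hS : ScaleShiftRate c θ γ β) (hL : HistLipschitz Λ γ β) (hΛ : ∀ k i, i ≤ k → 0 ≤ Λ k i)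
    (hexp : ∀ k, ∑ i ∈ range (k + 1), Λ k i * κ ^ i ≤ Mκ * κ ^ k)
    (hsign : BetaLowerH 0 γ β) (hlo : EventualLowerH b γ k₀ β)
    (hsmall : 2 * ((((k₀ : ℝ) + 1) * γ ^ 3 + 2 * γ / b) * Mκ) ≤ 1) :
    ∀ j, j ≤ K → disc gA gB j ≤ 2 * c / (1 - θ) * κ ^ j := by
  have hU := sum_weights_le_of_eventualLower hγ hb hA hB hAbox hBbox hlo
  have hmA := nearMono_of_sign hA (fun k hk => (hAbox k hk).1) (sign_along_of_betaLowerH hsign hAbox)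
  have hmB := nearMono_of_sign hB (fun k hk => (hBbox k hk).1) (sign_along_of_betaLowerH hsign hBbox)
  exact disc_le_geom_of_expMoment hc hθ0 hθ1 hθκ hκ0 hκ1 hA hB hAbox hBbox hpin hS hL hΛ hexp zero_le_one hmA hmB hU
    (by simpa using hsmall)

/-- **EVENTUAL FORM** (`A = √2`, no sign): two pinned runs as above under `ScaleShiftRate c θ γ β`, `HistLipschitz Λ γ β` (`Λ ≥ 0`)
with the tilted row budget `Σ_{i≤k} Λ k i·κ^i ≤ M_κ·κ^k`, the eventual floor `EventualLowerH b γ k₀ β` (`b > 0`), the lower half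
`β ≥ −β′` of the PRINTED-type two-sided bound (p. 264 «uniformly bounded», constant unprinted) and `k₀·β′·γ² ≤ 1∕2` ((E32)
`nearMono_of_eventualLower` BY NAME: `g_i ≤ √2·g_j`); SMALLNESS `2·(2√2)·U·M_κ ≤ 1`, `U = (k₀+1)γ³ + 2γ∕b`.  THEN
`disc gA gB j ≤ (2c∕(1−θ))·κ^j` for every `j ≤ K`. [cite: Balaban1987RG1, (0.20) p.256 and §1 p.264] -/
theorem disc_le_geom_of_expMoment_eventual {β : HBeta} {γ b β' c θ κ Mκ : ℝ} {k₀ : ℕ} {Λ : ℕ → ℕ → ℝ} {K : ℕ}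
    {gA gB : ℕ → ℝ}
    (hγ : 0 < γ) (hb : 0 < b) (hc : 0 ≤ c) (hθ0 : 0 ≤ θ) (hθ1 : θ < 1) (hθκ : θ ≤ κ) (hκ0 : 0 < κ) (hκ1 : κ ≤ 1)
    (hA : RGEqH K β gA) (hB : RGEqH (K + 1) β gB)
    (hAbox : ∀ i, i ≤ K → 0 < gA i ∧ gA i ≤ γ) (hBbox : ∀ i, i ≤ K + 1 → 0 < gB i ∧ gB i ≤ γ)
    (hpin : gA K = gB (K + 1))
    (hS : ScaleShiftRate c θ γ β) (hL : HistLipschitz Λ γ β) (hΛ : ∀ k i, i ≤ k → 0 ≤ Λ k i)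
    (hexp : ∀ k, ∑ i ∈ range (k + 1), Λ k i * κ ^ i ≤ Mκ * κ ^ k)
    (hlo : EventualLowerH b γ k₀ β) (hβ' : 0 ≤ β') (hlow : ∀ k v, v ∈ Box γ k → -β' ≤ β k v)
    (hk₀ : (k₀ : ℝ) * β' * γ ^ 2 ≤ 1 / 2)
    (hsmall : 2 * ((2 * Real.sqrt 2) * (((k₀ : ℝ) + 1) * γ ^ 3 + 2 * γ / b) * Mκ) ≤ 1) :
    ∀ j, j ≤ K → disc gA gB j ≤ 2 * c / (1 - θ) * κ ^ j := by
  have hU := sum_weights_le_of_eventualLower hγ hb hA hB hAbox hBbox hlo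
  have hmA := nearMono_of_eventualLower hA hAbox hb.le hlo hβ' hlow hk₀
  have hmB := nearMono_of_eventualLower hB hBbox hb.le hlo hβ' hlow hk₀
  have hs3 : Real.sqrt 2 ^ 3 = 2 * Real.sqrt 2 := by
    rw [pow_succ, Real.sq_sqrt (by norm_num : (0 : ℝ) ≤ 2)]
  exact disc_le_geom_of_expMoment hc hθ0 hθ1 hθκ hκ0 hκ1 hA hB hAbox hBbox hpin hS hL hΛ hexp (Real.sqrt_nonneg 2)
    hmA hmB hU (by rw [hs3]; exact hsmall)

/-- **FADING MEMORY WITH AN ARBITRARY CONSTANT.**  Two pinned runs as in `disc_le_geom_of_expMoment` under `ScaleShiftRate c θ γ β`,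
`HistLipschitz Λ γ β` with `FadingMemory C θ Λ` — ANY `C`, no smallness on it — and the k-uniform ROW total weight `Σ_{i≤k} Λ k i ≤ M`,
near-monotone runs (constant `A`), `Σ_{i≤K} (g^A_i)²g^B_{i+1} ≤ U`.  For every window `a` and ratio `θ < κ ≤ 1` with the SMALLNESS
`2·A³·U·(M + C·θ^{a+1}∕(κ−θ)) ≤ κ^a` — satisfiable from the ROW smallness `4·A³·U·M < 1` alone: take `a` with `C·θ^{a+1} ≤ M(1−θ)∕2`, then
`κ = max((1+θ)∕2, (4A³UM)^{1∕(a+1)})` ((E36b) `exists_ratio`) —: `disc gA gB j ≤ (2c∕(1−θ))·κ^j` for every `j ≤ K`.  Node U2's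
`disc_le_of_fadingMemory` asks `C·U ≤ (1−θ)∕2` instead and needs no monotonicity; here the fading constant is paid in the RATIO `κ`
(`κ^a ≥ 4A³UM`, `a ≍ log(C∕M)∕log(1∕θ)`), not in an admission condition. [cite: Balaban1987RG1, (0.20) p.256 and §5 p.298] -/
theorem disc_le_geom_of_fading {β : HBeta} {γ c θ κ C M A U : ℝ} {Λ : ℕ → ℕ → ℝ} {K a : ℕ} {gA gB : ℕ → ℝ}
    (hc : 0 ≤ c) (hθ0 : 0 ≤ θ) (hθκ : θ < κ) (hκ1 : κ ≤ 1)
    (hA : RGEqH K β gA) (hB : RGEqH (K + 1) β gB)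
    (hAbox : ∀ i, i ≤ K → 0 < gA i ∧ gA i ≤ γ) (hBbox : ∀ i, i ≤ K + 1 → 0 < gB i ∧ gB i ≤ γ)
    (hpin : gA K = gB (K + 1))
    (hS : ScaleShiftRate c θ γ β) (hL : HistLipschitz Λ γ β) (hF : FadingMemory C θ Λ)
    (hrow : ∀ k, ∑ i ∈ range (k + 1), Λ k i ≤ M) (hA0 : 0 ≤ A)
    (hmA : ∀ i j, i ≤ j → j ≤ K → gA i ≤ A * gA j) (hmB : ∀ i j, i ≤ j → j ≤ K + 1 → gB i ≤ A * gB j)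
    (hU : ∑ i ∈ range (K + 1), (gA i) ^ 2 * gB (i + 1) ≤ U)
    (hsmall : 2 * (A ^ 3 * U * (M + C * θ ^ (a + 1) / (κ - θ))) ≤ κ ^ a) :
    ∀ j, j ≤ K → disc gA gB j ≤ 2 * c / (1 - θ) * κ ^ j := by
  have hκ0 : 0 < κ := lt_of_le_of_lt hθ0 hθκ
  have hθ1 : θ < 1 := lt_of_lt_of_le hθκ hκ1
  have hκa : 0 < κ ^ a := pow_pos hκ0 a
  have hΛ : ∀ k i, i ≤ k → 0 ≤ Λ k i := fun k i hik => (hF k i hik).1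
  have hexp : ∀ k, ∑ i ∈ range (k + 1), Λ k i * κ ^ i ≤ (M + C * θ ^ (a + 1) / (κ - θ)) / κ ^ a * κ ^ k :=
    fun k => expMoment_of_fading a hθ0 hθκ hκ1 (fun i hi => (hF k i hi).1) (fun i hi => (hF k i hi).2) (hrow k)
  have hw : ∀ i, i ≤ K → 0 ≤ (gA i) ^ 2 * gB (i + 1) := fun i hi =>
    mul_nonneg (sq_nonneg _) (hBbox (i + 1) (by omega)).1.le
  have hU0 : 0 ≤ U := (sum_nonneg fun i hi => hw i (Nat.lt_succ_iff.mp (mem_range.mp hi))).trans hU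
  have hsmall' : 2 * (A ^ 3 * U * ((M + C * θ ^ (a + 1) / (κ - θ)) / κ ^ a)) ≤ 1 := by
    rw [show 2 * (A ^ 3 * U * ((M + C * θ ^ (a + 1) / (κ - θ)) / κ ^ a))
        = 2 * (A ^ 3 * U * (M + C * θ ^ (a + 1) / (κ - θ))) / κ ^ a by ring]
    rwa [div_le_one hκa]
  exact disc_le_geom_of_expMoment hc hθ0 hθ1 hθκ.le hκ0 hκ1 hA hB hAbox hBbox hpin hS hL hΛ hexp hA0 hmA hmB hU hsmall'

/-- **FADING MEMORY WITH AN ARBITRARY CONSTANT — SIGN FORM** (`A = 1`, `U = (k₀+1)γ³ + 2γ∕b`): `ScaleShiftRate c θ γ β`,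
`HistLipschitz Λ γ β`, `FadingMemory C θ Λ` (ANY `C`), rows `≤ M`, the sign `BetaLowerH 0 γ β`, the eventual floor `EventualLowerH b γ k₀ β`
(`b > 0`); window `a` and ratio `θ < κ ≤ 1` with `2·U·(M + C·θ^{a+1}∕(κ−θ)) ≤ κ^a`.  THEN `disc gA gB j ≤ (2c∕(1−θ))·κ^j` for every
`j ≤ K`.  On the D4 column the floor and the sign are what the JUNCTION buys (OWNER's `betaLowerTail_of_remainderConst`); the row budget
`M` is (D4-J2)'s junction currency. [cite: Balaban1987RG1, (0.20) p.256 and (0.31) p.259] -/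
theorem disc_le_geom_of_fading_sign {β : HBeta} {γ b c θ κ C M : ℝ} {k₀ a : ℕ} {Λ : ℕ → ℕ → ℝ} {K : ℕ} {gA gB : ℕ → ℝ}
    (hγ : 0 < γ) (hb : 0 < b) (hc : 0 ≤ c) (hθ0 : 0 ≤ θ) (hθκ : θ < κ) (hκ1 : κ ≤ 1)
    (hA : RGEqH K β gA) (hB : RGEqH (K + 1) β gB)
    (hAbox : ∀ i, i ≤ K → 0 < gA i ∧ gA i ≤ γ) (hBbox : ∀ i, i ≤ K + 1 → 0 < gB i ∧ gB i ≤ γ)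
    (hpin : gA K = gB (K + 1))
    (hS : ScaleShiftRate c θ γ β) (hL : HistLipschitz Λ γ β) (hF : FadingMemory C θ Λ)
    (hrow : ∀ k, ∑ i ∈ range (k + 1), Λ k i ≤ M)
    (hsign : BetaLowerH 0 γ β) (hlo : EventualLowerH b γ k₀ β)
    (hsmall : 2 * ((((k₀ : ℝ) + 1) * γ ^ 3 + 2 * γ / b) * (M + C * θ ^ (a + 1) / (κ - θ))) ≤ κ ^ a) :
    ∀ j, j ≤ K → disc gA gB j ≤ 2 * c / (1 - θ) * κ ^ j := by
  have hU := sum_weights_le_of_eventualLower hγ hb hA hB hAbox hBbox hlo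
  have hmA := nearMono_of_sign hA (fun k hk => (hAbox k hk).1) (sign_along_of_betaLowerH hsign hAbox)
  have hmB := nearMono_of_sign hB (fun k hk => (hBbox k hk).1) (sign_along_of_betaLowerH hsign hBbox)
  exact disc_le_geom_of_fading hc hθ0 hθκ hκ1 hA hB hAbox hBbox hpin hS hL hF hrow zero_le_one hmA hmB hU
    (by simpa using hsmall)

end Summit.QuantumFields.BalabanUV.Beta.EriceRemainderEnclosureHistoryFading

end
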